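import Summits.ResolutionOfSingularities.ResolutionOfSingularities.Theorems.FrobeniusClosingNoPeriodicIsolatedAtomStepDictAux1
import Summits.ResolutionOfSingularities.ResolutionOfSingularities.Theorems.FrobeniusClosingNoPeriodicIsolatedAtomStepDictAux2

/-!
# Step dictionary for `NoPeriodicIsolatedAtom` / line `ridge_rank`: stub `stub_stepDict`

Crux stmt-ResolutionOfSingularities-16344
(`Summit.ResolutionOfSingularities.ResolutionOfSingularities.Theses.FrobeniusClosing.NoPeriodicIsolatedAtom`),
registered stub `stub_stepDict` — THE STEP DICTIONARY, the only stub of the line that opens the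
coefficient calculus `bl / dv / tr / clean` inside `step` (exact mirror
`Theorems/ConeExit/Negative/Mirror.lean`; the predicates `MultP`, `OrdP` are displayed inline).

For a state `c` of multiplicity `p` (so one step divides by `u_i ^ p` exactly), chart `i`,
translation `τ`:
* (a) with no cleaned monomial of degree exactly `p`, every coefficient of the successor at an
  exponent `B` with `B i = 0` vanishes (`StepDict.stepDict_a`, auxiliary file 2);
* (b) the `u_i`-free degree-`p` coefficients are unchanged (`StepDict.stepDict_b`, file 2);
* (c) if the successor again has multiplicity `p`, the CONE SHAPE identity
  `a_p(X_i, X' + τ X_i) = a_p(e_i + τ) X_i^p + a_p(0, X')` for `a_p = cone p c`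
  (`StepDict.stepDict_c` below): both sides are compared coefficientwise; the coefficient of
  `X^E` on the left is the homogeneous Taylor sum `∑_{|A| = p} clean c A ∏_{j ≠ i} C(A_j, E_j) τ_j^{A_j - E_j}`
  (file 1, `coeff_shear_monomial`); at `E = p e_i` it is `a_p(e_i + τ)`, on the face `E_i = 0`
  only `A = E` survives, and for `0 < E_i < p` it is the window sum of the successor's coefficient
  at `E` with `E_i ↦ 0` (file 2, `tr_dv_bl_eq_sum_degree`), which multiplicity `p` of the successor
  kills (total degree `p - E_i ∈ (0, p)`, not all coordinates divisible by `p`).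
-/

noncomputable section

-- single-problem summit: the doubled namespace component is forced by the tree layout
set_option linter.dupNamespace false

namespace Summit.ResolutionOfSingularities.ResolutionOfSingularities.Theorems.NoPeriodicIsolatedAtom.RidgeRank

open Summit.ResolutionOfSingularities.ResolutionOfSingularities.Theorems.ConeExit.Negative
open Summit.ResolutionOfSingularities.ResolutionOfSingularities.Theorems.WildConesConeExit (faceDict_ord_ge)
open scoped BigOperators Classical
open MvPolynomial

namespace StepDict

variable {n : ℕ} {κ : Type} [Field κ]

/-! ## The cone as a sum of monomials over the degree-`p` window -/

/-- `cone p c` as a sum of monomials over the exponents of total degree `p`. [folklore] -/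
theorem cone_eq_filter (p : ℕ) (c : (Fin n → ℕ) → κ) :
    cone p c = Finset.sum ((Fintype.piFinset (fun _ : Fin n => Finset.range (p + 1))).filter
        (fun A => Finset.sum Finset.univ (fun j => A j) = p))
      (fun A => monomial (Finsupp.equivFunOnFinite.symm A) (clean p c A)) := by
  rw [Finset.sum_filter]
  unfold cone
  exact Finset.sum_congr rfl (fun A _ => by split_ifs <;> rfl)

/-- An exponent of total degree `p` lies in the degree-`p` window. [folklore] -/
theorem coe_mem_window (p : ℕ) (E : Fin n →₀ ℕ) (hE : E.degree = p) :
    (⇑E : Fin n → ℕ) ∈ (Fintype.piFinset (fun _ : Fin n => Finset.range (p + 1))).filter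
      (fun A => Finset.sum Finset.univ (fun j => A j) = p) := by
  rw [Finset.mem_filter, Fintype.mem_piFinset, ← hE, Finsupp.degree_eq_sum]
  refine ⟨fun j => Finset.mem_range.mpr (Nat.lt_succ_of_le ?_), rfl⟩
  exact Finset.single_le_sum (f := fun k => E k) (fun k _ => Nat.zero_le _) (Finset.mem_univ j)

/-- **Coefficients of the sheared cone** `a_p(X_i, X' + τ X_i)`: the homogeneous Taylor sum.
[folklore] -/
theorem coeff_shear_cone (p : ℕ) (c : (Fin n → ℕ) → κ) (i : Fin n) (τ : Fin n → κ)
    (E : Fin n →₀ ℕ) :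
    coeff E (aeval (fun j : Fin n => if j = i then X i else X j + C (τ j) * X i) (cone p c)) =
      Finset.sum ((Fintype.piFinset (fun _ : Fin n => Finset.range (p + 1))).filter
          (fun A => Finset.sum Finset.univ (fun j => A j) = p))
        (fun A => if Finset.sum Finset.univ (fun j => A j) = E.degree then
          clean p c A * Finset.prod (Finset.univ.erase i)
            (fun j => ((Nat.choose (A j) (E j) : ℕ) : κ) * τ j ^ (A j - E j)) else 0) := by
  rw [cone_eq_filter, map_sum, coeff_sum]
  refine Finset.sum_congr rfl (fun A _ => ?_)
  rw [coeff_shear_monomial, Finsupp.degree_eq_sum]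
  rfl

/-- **Coefficients of the `X_i`-free part** `a_p(0, X')`. [folklore] -/
theorem coeff_kill_cone (p : ℕ) (c : (Fin n → ℕ) → κ) (i : Fin n) (E : Fin n →₀ ℕ) :
    coeff E (aeval (fun j : Fin n => if j = i then (0 : MvPolynomial (Fin n) κ) else X j) (cone p c)) =
      if E i = 0 ∧ E.degree = p then clean p c ⇑E else 0 := by
  rw [cone_eq_filter, map_sum, coeff_sum]
  simp_rw [coeff_kill_monomial]
  by_cases h : E i = 0 ∧ E.degree = p
  · rw [if_pos h, Finset.sum_eq_single_of_mem (⇑E) (coe_mem_window p E h.2)]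
    · exact if_pos ⟨h.1, Finsupp.equivFunOnFinite_symm_coe E⟩
    · intro A _ hne
      rw [if_neg]
      rintro ⟨_, hAE⟩
      exact hne (by rw [← hAE]; rfl)
  · rw [if_neg h]
    refine Finset.sum_eq_zero (fun A hA => if_neg ?_)
    rintro ⟨hAi, hAE⟩
    apply h
    subst hAE
    rw [Finset.mem_filter] at hA
    exact ⟨hAi, by rw [Finsupp.degree_eq_sum]; exact hA.2⟩

/-- **Values of the cone**: `a_p(σ) = ∑_{|A| = p} clean c A · σ^A`. [folklore] -/
theorem eval_cone (p : ℕ) (c : (Fin n → ℕ) → κ) (σ : Fin n → κ) :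
    eval σ (cone p c) = Finset.sum ((Fintype.piFinset (fun _ : Fin n => Finset.range (p + 1))).filter
        (fun A => Finset.sum Finset.univ (fun j => A j) = p))
      (fun A => clean p c A * Finset.prod Finset.univ (fun j => σ j ^ (A j))) := by
  rw [cone_eq_filter, map_sum]
  refine Finset.sum_congr rfl (fun A _ => ?_)
  rw [eval_monomial_fintype]
  rfl

/-- Two distinct exponents of the same total degree, the second vanishing at `i`: the first is
strictly smaller somewhere off `i` (so the binomial `C(A_j, B_j)` vanishes). [folklore] -/
theorem exists_lt_of_ne_of_sum_eq (i : Fin n) (A B : Fin n → ℕ) (hBi : B i = 0)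
    (hsum : Finset.sum Finset.univ (fun j => A j) = Finset.sum Finset.univ (fun j => B j))
    (hne : A ≠ B) : ∃ j, j ≠ i ∧ A j < B j := by
  by_contra hcon
  push Not at hcon
  have hle : ∀ j ∈ Finset.univ.erase i, B j ≤ A j := fun j hj => hcon j (Finset.ne_of_mem_erase hj)
  rw [sum_univ_eq_add_sum_erase i A, sum_univ_eq_add_sum_erase i B, hBi, zero_add] at hsum
  have h1 : Finset.sum (Finset.univ.erase i) (fun j => B j) ≤
      Finset.sum (Finset.univ.erase i) (fun j => A j) := Finset.sum_le_sum hle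
  have hAi : A i = 0 := by omega
  have heq : Finset.sum (Finset.univ.erase i) (fun j => B j) =
      Finset.sum (Finset.univ.erase i) (fun j => A j) := by omega
  rw [Finset.sum_eq_sum_iff_of_le hle] at heq
  apply hne
  funext j
  by_cases hj : j = i
  · rw [hj, hAi, hBi]
  · exact (heq j (Finset.mem_erase.mpr ⟨hj, Finset.mem_univ j⟩)).symm

/-! ## (c) The cone shape -/

/-- **Step dictionary (c): the cone shape.** From a state of multiplicity `p` whose successor in
chart `i` at translation `τ` again has multiplicity `p`,
`a_p(X_i, X' + τ X_i) = a_p(e_i + τ) · X_i ^ p + a_p(0, X')`. [folklore] -/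
theorem stepDict_c (p : ℕ) (hp : p.Prime) (c : (Fin n → ℕ) → κ) (i : Fin n) (τ : Fin n → κ)
    (hmult : (∃ A, clean p c A ≠ 0) ∧ ∀ A, clean p c A ≠ 0 → p ≤ Finset.sum Finset.univ (fun j => A j))
    (hmult' : (∃ A, clean p (step p i τ c) A ≠ 0) ∧
      ∀ A, clean p (step p i τ c) A ≠ 0 → p ≤ Finset.sum Finset.univ (fun j => A j)) :
    aeval (fun j : Fin n => if j = i then X i else X j + C (τ j) * X i) (cone p c) =
      C (eval (Function.update τ i 1) (cone p c)) * X i ^ p +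
        aeval (fun j : Fin n => if j = i then (0 : MvPolynomial (Fin n) κ) else X j) (cone p c) := by
  -- the window sums killed by multiplicity `p` of the successor
  have hvan : ∀ B : Fin n → ℕ, B i = 0 → 0 < Finset.sum Finset.univ (fun j => B j) →
      Finset.sum Finset.univ (fun j => B j) < p →
      Finset.sum ((Fintype.piFinset (fun _ : Fin n => Finset.range (p + 1))).filter
          (fun A => Finset.sum Finset.univ (fun j => A j) = p))
        (fun A => clean p c A * Finset.prod (Finset.univ.erase i)
          (fun j => ((Nat.choose (A j) (B j) : ℕ) : κ) * τ j ^ (A j - B j))) = 0 := by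
    intro B hBi hpos hlt
    rw [← tr_dv_bl_eq_sum_degree p i τ (clean p c) B hBi]
    have hndiv : ¬ ∀ j, p ∣ B j := by
      intro hdiv
      have hzero : ∀ j, B j = 0 := fun j => Nat.eq_zero_of_dvd_of_lt (hdiv j)
        (lt_of_le_of_lt (Finset.single_le_sum (f := fun k => B k) (fun k _ => Nat.zero_le _)
          (Finset.mem_univ j)) hlt)
      have h0 : Finset.sum Finset.univ (fun j => B j) = 0 := Finset.sum_eq_zero (fun j _ => hzero j)
      omega
    have hstep : clean p (step p i τ c) B = 0 := by
      by_contra hne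
      have := hmult'.2 B hne
      omega
    rw [step_eq_of_le_ord p c i τ (faceDict_ord_ge p c hmult), clean_apply, if_neg hndiv, clean_apply,
      if_neg hndiv] at hstep
    exact hstep
  have hp0 : p ≠ 0 := hp.ne_zero
  -- coefficientwise comparison
  apply MvPolynomial.ext
  intro E
  rw [coeff_shear_cone, coeff_add, coeff_C_mul, coeff_X_pow, coeff_kill_cone]
  have hdegE : E.degree = E i + Finset.sum (Finset.univ.erase i) (fun j => E j) := by
    rw [Finsupp.degree_eq_sum]; exact sum_univ_eq_add_sum_erase i ⇑E
  by_cases hdeg : E.degree = p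
  · by_cases hEi : E i = 0
    · -- the face `E i = 0`: only `A = E` contributes
      have hns : ¬ Finsupp.single i p = E := fun h => by
        have h' := DFunLike.congr_fun h i
        rw [Finsupp.single_eq_same] at h'
        omega
      rw [if_neg hns, mul_zero, zero_add, if_pos ⟨hEi, hdeg⟩,
        Finset.sum_eq_single_of_mem (⇑E) (coe_mem_window p E hdeg)]
      · rw [if_pos (Finsupp.degree_eq_sum E).symm]
        have hprod : Finset.prod (Finset.univ.erase i)
            (fun j => ((Nat.choose (E j) (E j) : ℕ) : κ) * τ j ^ (E j - E j)) = 1 :=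
          Finset.prod_eq_one (fun j _ => by simp)
        rw [hprod, mul_one]
      · intro A hA hne
        by_cases hc : Finset.sum Finset.univ (fun j => A j) = E.degree
        · rw [if_pos hc]
          rw [Finsupp.degree_eq_sum] at hc
          obtain ⟨j, hji, hlt⟩ := exists_lt_of_ne_of_sum_eq i A ⇑E hEi hc hne
          refine mul_eq_zero_of_right _ (Finset.prod_eq_zero
            (Finset.mem_erase.mpr ⟨hji, Finset.mem_univ j⟩) ?_)
          rw [Nat.choose_eq_zero_of_lt hlt, Nat.cast_zero, zero_mul]
        · rw [if_neg hc]
    · by_cases hEp : E i = p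
      · -- the vertex `E = p e_i`: the value `a_p(e_i + τ)`
        have hEj : ∀ j, j ≠ i → E j = 0 := by
          have h0 : Finset.sum (Finset.univ.erase i) (fun j => E j) = 0 := by omega
          intro j hj
          exact (Finset.sum_eq_zero_iff_of_nonneg (fun _ _ => Nat.zero_le _)).mp h0 j
            (Finset.mem_erase.mpr ⟨hj, Finset.mem_univ j⟩)
        have hsingle : Finsupp.single i p = E := by
          ext j
          by_cases hj : j = i
          · rw [hj, Finsupp.single_eq_same, hEp]
          · rw [Finsupp.single_apply, if_neg (Ne.symm hj), hEj j hj]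
        rw [if_pos hsingle, mul_one, if_neg (fun h => hEi h.1), add_zero, eval_cone]
        refine Finset.sum_congr rfl (fun A hA => ?_)
        rw [Finset.mem_filter] at hA
        rw [if_pos (hA.2.trans hdeg.symm), ← Finset.mul_prod_erase _ _ (Finset.mem_univ i),
          Function.update_self, one_pow, one_mul]
        congr 1
        refine Finset.prod_congr rfl (fun j hj => ?_)
        rw [hEj j (Finset.ne_of_mem_erase hj), Nat.choose_zero_right, Nat.cast_one, one_mul,
          Nat.sub_zero, Function.update_of_ne (Finset.ne_of_mem_erase hj)]
      · -- the middle `0 < E i < p`: a window sum of the successor, killed by `MultP`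
        have hns : ¬ Finsupp.single i p = E := fun h => by
          have h' := DFunLike.congr_fun h i
          rw [Finsupp.single_eq_same] at h'
          exact hEp h'.symm
        rw [if_neg hns, mul_zero, zero_add, if_neg (fun h => hEi h.1)]
        have hEile : E i ≤ p := by rw [← hdeg, hdegE]; omega
        have hBsum : Finset.sum Finset.univ (fun j => (if j = i then 0 else E j)) =
            Finset.sum (Finset.univ.erase i) (fun j => E j) := sum_ite_eq_sum_erase i ⇑E
        have hBpos : 0 < Finset.sum Finset.univ (fun j => (if j = i then 0 else E j)) := by
          rw [hBsum]; omega
        have hBlt : Finset.sum Finset.univ (fun j => (if j = i then 0 else E j)) < p := by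
          rw [hBsum]; omega
        have h0 := hvan (fun j => if j = i then 0 else E j) (if_pos rfl) hBpos hBlt
        refine Eq.trans (Finset.sum_congr rfl (fun A hA => ?_)) h0
        rw [Finset.mem_filter] at hA
        rw [if_pos (hA.2.trans hdeg.symm)]
        congr 1
        refine Finset.prod_congr rfl (fun j hj => ?_)
        simp only [if_neg (Finset.ne_of_mem_erase hj)]
  · -- off total degree `p` everything vanishes
    have hns : ¬ Finsupp.single i p = E := fun h => hdeg (by rw [← h, Finsupp.degree_single])
    rw [if_neg hns, mul_zero, zero_add, if_neg (fun h => hdeg h.2)]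
    refine Finset.sum_eq_zero (fun A hA => if_neg (fun h => hdeg ?_))
    rw [Finset.mem_filter] at hA
    rw [← h]
    exact hA.2

end StepDict

open StepDict in
/-- **STUB `stub_stepDict` — THE STEP DICTIONARY** of the line `ridge_rank` (crux
stmt-ResolutionOfSingularities-16344), stated over the exact mirror of the crux's calculus with the
predicate `MultP` displayed inline: for a state `c` of multiplicity `p`, chart `i`, translation `τ`,
(a) with no cleaned degree-`p` monomial the successor's coefficients at exponents `B`, `B i = 0`,
vanish; (b) the `u_i`-free degree-`p` coefficients are unchanged by the step; (c) if the successor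
has multiplicity `p`, the cone shape `a_p(X_i, X' + τ X_i) = a_p(e_i + τ) X_i^p + a_p(0, X')`.
[cite: HauserPerlega2019, §2] -/
theorem stub_stepDict : ∀ p : ℕ, p.Prime → ∀ (n : ℕ) (κ : Type) [Field κ] (c : (Fin n → ℕ) → κ) (i : Fin n) (τ : Fin n → κ),
    ((∃ A, clean p c A ≠ 0) ∧ ∀ A, clean p c A ≠ 0 → p ≤ Finset.sum Finset.univ (fun j => A j)) →
    ((∀ A, clean p c A ≠ 0 → Finset.sum Finset.univ (fun j => A j) ≠ p) →
        ∀ B : Fin n → ℕ, B i = 0 → clean p (step p i τ c) B = 0) ∧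
    (∀ A : Fin n → ℕ, A i = 0 → Finset.sum Finset.univ (fun j => A j) = p →
        clean p (step p i τ c) A = clean p c A) ∧
    (((∃ A, clean p (step p i τ c) A ≠ 0) ∧ ∀ A, clean p (step p i τ c) A ≠ 0 → p ≤ Finset.sum Finset.univ (fun j => A j)) →
        MvPolynomial.aeval (fun j : Fin n => if j = i then MvPolynomial.X i
            else MvPolynomial.X j + MvPolynomial.C (τ j) * MvPolynomial.X i) (cone p c) =
          MvPolynomial.C (MvPolynomial.eval (Function.update τ i 1) (cone p c)) * MvPolynomial.X i ^ p +
            MvPolynomial.aeval (fun j : Fin n => if j = i then 0 else MvPolynomial.X j) (cone p c)) :=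
  fun p hp _n _κ _ c i τ hmult =>
    ⟨fun hno B hB => stepDict_a p c i τ hmult hno B hB,
     fun A hAi hdeg => stepDict_b p c i τ hmult A hAi hdeg,
     fun hmult' => stepDict_c p hp c i τ hmult hmult'⟩

end Summit.ResolutionOfSingularities.ResolutionOfSingularities.Theorems.NoPeriodicIsolatedAtom.RidgeRank

end
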